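import Mathlib.Algebra.MonoidAlgebra.Basic
import Mathlib.Algebra.MonoidAlgebra.Support
import Mathlib.Algebra.MonoidAlgebra.Module
import Mathlib.Algebra.MvPolynomial.CommRing
import Mathlib.Algebra.MvPolynomial.NoZeroDivisors
import Literature.Computability.MetaComplexity.SumOfSquares
import Literature.Computability.MetaComplexity.XorDerivation
import Literature.Computability.MetaComplexity.ScopeExpansion
import HarnessLib

/-!
# Grigoriev–Schoenebeck pseudo-moments from boundary expansion, II: the pseudoexpectation

Trunk Literature/Computability/MetaComplexity; support for discharging `kmow_sos_random_kSAT`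
(`SumOfSquares.lean`). Given the pseudo-moments `Ẽ[y_T]` of `XorDerivation.lean` we build the
degree-`d` pseudoexpectation of `SumOfSquares.lean` (a linear functional on `MvPolynomial ℕ ℝ`)
and prove the deterministic half of the KMOW theorem for `k`-SAT in its classical
Grigoriev–Schoenebeck form:

* `ParityAlg = ℝ[ParityVec]`, the group algebra of the Boolean group of parity vectors (the ring
  of multilinear polynomials in `±1` variables `y_v`, `y_T y_U = y_{T+U}`), `yMon T = y_T`;
* `phi : MvPolynomial ℕ ℝ →ₐ[ℝ] ParityAlg`, `X v ↦ (1 - y_v)/2` — the `0/1 ↔ ±1` change of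
  variables composed with multilinearisation; it kills the Booleanity axioms (`phi_boolAxiom`) and
  does not increase degree (`card_support_le_totalDegree`);
* `momentFunctional e : ParityAlg →ₗ[ℝ] ℝ`, `y_T ↦ e T`;
* `gsPseudoexpectation φ r c d … = momentFunctional Ẽ ∘ phi` and the theorem
  `sosFailsToRefute_of_isBoundaryExpander`: if the clauses of `φ` have pairwise distinct
  variables and the scopes form an `(r, c)`-boundary expander with `r ≥ 2`, then degree-`d` SOS
  fails to refute `φ` for every `d ≤ c r / 2` (normalisation, positivity from
  `pseudoMoment_quadratic_nonneg`, clause identities from the complement pairing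
  `J ↔ positions ∖ J` of the Fourier expansion of `unsatPoly C`).

## References

* D. Grigoriev, *Linear lower bound on degrees of Positivstellensatz calculus proofs for the
  parity*, Theoret. Comput. Sci. 259 (2001), §2.
* G. Schoenebeck, *Linear level Lasserre lower bounds for certain k-CSPs*, FOCS 2008, §4
  (Thm. 4.1, Lemma 4.4), §5 (from `k`-XOR to `k`-SAT).
* P. K. Kothari, R. Mori, R. O'Donnell, D. Witmer, arXiv:1701.04521, §2.3, Thm. 2.9 / Thm. 7.1.
-/

noncomputable section

open Finset MvPolynomial Literature.Computability.Complexity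
open scoped symmDiff

namespace Literature.Computability.MetaComplexity

/-! ### The group algebra of parity vectors and the moment functional -/

/-- The real group algebra of the Boolean group of parity vectors: multilinear polynomials in
`±1`-valued variables, `y_T · y_U = y_{T+U}`. [Grigoriev 2001, §2; Schoenebeck 2008, §4] [folklore] -/
abbrev ParityAlg : Type := AddMonoidAlgebra ℝ ParityVec

/-- The monomial `y_T = ∏_{v ∈ T} y_v`. [Grigoriev 2001, §2] [folklore] -/
def yMon (T : ParityVec) : ParityAlg :=
  AddMonoidAlgebra.single T 1

/-- `y_T y_U = y_{T+U}`. [folklore] -/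
theorem yMon_mul (T U : ParityVec) : yMon T * yMon U = yMon (T + U) := by
  simp [yMon, AddMonoidAlgebra.single_mul_single]

/-- `y_0 = 1`. [folklore] -/
theorem yMon_zero : yMon 0 = 1 := AddMonoidAlgebra.one_def.symm

/-- `y_T² = 1`. [folklore] -/
theorem yMon_mul_self (T : ParityVec) : yMon T * yMon T = 1 := by
  rw [yMon_mul, ParityVec.add_self, yMon_zero]

/-- `a • y_T` is the group-algebra element `single T a`. [folklore] -/
theorem smul_yMon (a : ℝ) (T : ParityVec) : a • yMon T = AddMonoidAlgebra.single T a := by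
  rw [yMon, AddMonoidAlgebra.smul_single', mul_one]

/-- The MOMENT FUNCTIONAL of a moment sequence `e`: the linear functional `y_T ↦ e T`.
[Grigoriev 2001, §2; Kothari–Mori–O'Donnell–Witmer 2017, Def. 2.7] [folklore] -/
def momentFunctional (e : ParityVec → ℝ) : ParityAlg →ₗ[ℝ] ℝ :=
  Finsupp.linearCombination ℝ e ∘ₗ (AddMonoidAlgebra.coeffLinearEquiv ℝ).toLinearMap

/-- Value on a monomial. [folklore] -/
@[simp] theorem momentFunctional_single (e : ParityVec → ℝ) (T : ParityVec) (a : ℝ) :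
    momentFunctional e (AddMonoidAlgebra.single T a) = a * e T := by
  simp [momentFunctional, Finsupp.linearCombination_single]

/-- Value on a product: `L(x z) = Σ_{T,U} x_T z_U e(T + U)`. [folklore] -/
theorem momentFunctional_mul (e : ParityVec → ℝ) (x z : ParityAlg) :
    momentFunctional e (x * z) =
      ∑ T ∈ x.coeff.support, ∑ U ∈ z.coeff.support, x.coeff T * z.coeff U * e (T + U) := by
  rw [AddMonoidAlgebra.mul_def, map_finsuppSum, Finsupp.sum]
  refine Finset.sum_congr rfl fun T _ => ?_
  rw [map_finsuppSum, Finsupp.sum]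
  refine Finset.sum_congr rfl fun U _ => ?_
  rw [momentFunctional_single]

/-- Value on `single T a * z`. [folklore] -/
theorem momentFunctional_single_mul (e : ParityVec → ℝ) (T : ParityVec) (a : ℝ) (z : ParityAlg) :
    momentFunctional e (AddMonoidAlgebra.single T a * z) =
      ∑ U ∈ z.coeff.support, a * z.coeff U * e (T + U) := by
  classical
  rw [momentFunctional_mul]
  by_cases ha : a = 0
  · subst ha
    simp
  · rw [AddMonoidAlgebra.coeff_single, Finsupp.support_single _ ha, Finset.sum_singleton,
      Finsupp.single_eq_same]

/-! ### The arithmetisation `x_v ↦ (1 - y_v)/2` -/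

/-- The image of the `0/1` variable `x_v`: `(1 - y_v)/2`. [Grigoriev 2001, §2; Schoenebeck 2008,
§5] [folklore] -/
def phiX (v : ℕ) : ParityAlg :=
  (1 / 2 : ℝ) • (1 - yMon (Finsupp.single v 1))

/-- The arithmetisation homomorphism `ℝ[x_v : v ∈ ℕ] → ℝ[ParityVec]`, `x_v ↦ (1 - y_v)/2`
(multilinearisation followed by the `0/1 ↔ ±1` change of variables). [Grigoriev 2001, §2;
Schoenebeck 2008, §5] [folklore] -/
def phi : MvPolynomial ℕ ℝ →ₐ[ℝ] ParityAlg :=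
  MvPolynomial.aeval phiX

/-- `phi (x_v) = (1 - y_v)/2`. [folklore] -/
@[simp] theorem phi_X (v : ℕ) : phi (X v) = phiX v :=
  MvPolynomial.aeval_X _ _

/-- `((1 - y_v)/2)² = (1 - y_v)/2` since `y_v² = 1`: the arithmetisation is Boolean. [Grigoriev
2001, §2] [folklore] -/
theorem phiX_mul_self (v : ℕ) : phiX v * phiX v = phiX v := by
  unfold phiX
  set Y := yMon (Finsupp.single v 1) with hYdef
  have hY : Y * Y = 1 := yMon_mul_self _
  rw [Algebra.smul_def]
  set C := algebraMap ℝ ParityAlg (1 / 2 : ℝ) with hC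
  have h2C : 2 * C = 1 := by
    rw [hC, show (2 : ParityAlg) = algebraMap ℝ ParityAlg 2 from (map_ofNat _ 2).symm, ← map_mul,
      show (2 : ℝ) * (1 / 2) = 1 by norm_num, map_one]
  linear_combination C ^ 2 * hY + (1 - Y) * C * h2C

/-- The Booleanity axioms die under `phi`: `phi (x_v² - x_v) = 0`. [Grigoriev 2001, §2] [folklore] -/
theorem phi_boolAxiom (v : ℕ) : phi (boolAxiom v) = 0 := by
  rw [boolAxiom, map_sub, map_pow, phi_X, sq, phiX_mul_self, sub_self]

/-! ### Degree control: `phi` does not create long monomials -/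

/-- All monomials `y_T` occurring in `x` have `T ⊆ B`. [folklore] -/
def SuppIn (B : Finset ℕ) (x : ParityAlg) : Prop :=
  ∀ T ∈ x.coeff.support, T.support ⊆ B

/-- Monotonicity in the bounding set. [folklore] -/
theorem SuppIn.mono {B B' : Finset ℕ} {x : ParityAlg} (h : SuppIn B x) (hB : B ⊆ B') :
    SuppIn B' x :=
  fun T hT => (h T hT).trans hB

/-- `single T a` is bounded by `supp T`. [folklore] -/
theorem suppIn_single {B : Finset ℕ} {T : ParityVec} (hT : T.support ⊆ B) (a : ℝ) :
    SuppIn B (AddMonoidAlgebra.single T a) := by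
  intro U hU
  rw [AddMonoidAlgebra.coeff_single] at hU
  have := Finsupp.support_single_subset hU
  rw [Finset.mem_singleton] at this
  rwa [this]

/-- `1` is bounded by anything. [folklore] -/
theorem suppIn_one (B : Finset ℕ) : SuppIn B (1 : ParityAlg) := by
  rw [AddMonoidAlgebra.one_def]
  exact suppIn_single (by simp) 1

/-- Sums stay bounded. [folklore] -/
theorem SuppIn.add {B : Finset ℕ} {x z : ParityAlg} (hx : SuppIn B x) (hz : SuppIn B z) :
    SuppIn B (x + z) := by
  intro T hT
  rw [AddMonoidAlgebra.coeff_add] at hT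
  rcases Finset.mem_union.1 (Finsupp.support_add hT) with h | h
  · exact hx T h
  · exact hz T h

/-- Negation stays bounded. [folklore] -/
theorem SuppIn.neg {B : Finset ℕ} {x : ParityAlg} (hx : SuppIn B x) : SuppIn B (-x) := by
  intro T hT
  rw [AddMonoidAlgebra.coeff_neg, Finsupp.support_neg] at hT
  exact hx T hT

/-- Differences stay bounded. [folklore] -/
theorem SuppIn.sub {B : Finset ℕ} {x z : ParityAlg} (hx : SuppIn B x) (hz : SuppIn B z) :
    SuppIn B (x - z) := by
  rw [sub_eq_add_neg]; exact hx.add hz.neg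

/-- Scalar multiples stay bounded. [folklore] -/
theorem SuppIn.smul {B : Finset ℕ} {x : ParityAlg} (hx : SuppIn B x) (a : ℝ) : SuppIn B (a • x) := by
  intro T hT
  rw [AddMonoidAlgebra.coeff_smul] at hT
  exact hx T (Finsupp.support_smul hT)

/-- Finite sums stay bounded. [folklore] -/
theorem SuppIn.sum {κ : Type*} {B : Finset ℕ} {s : Finset κ} {f : κ → ParityAlg}
    (h : ∀ i ∈ s, SuppIn B (f i)) : SuppIn B (∑ i ∈ s, f i) := by
  classical
  induction s using Finset.induction_on with
  | empty => intro T hT; simp at hT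
  | insert a s ha ih =>
    rw [Finset.sum_insert ha]
    exact (h a (Finset.mem_insert_self a s)).add (ih fun i hi => h i (Finset.mem_insert_of_mem hi))

/-- Products: bounding sets unite (`y_T y_U = y_{T+U}`, `supp (T+U) ⊆ supp T ∪ supp U`).
[folklore] -/
theorem SuppIn.mul {B B' : Finset ℕ} {x z : ParityAlg} (hx : SuppIn B x) (hz : SuppIn B' z) :
    SuppIn (B ∪ B') (x * z) := by
  classical
  intro T hT
  have := AddMonoidAlgebra.support_coeff_mul_subset x z hT
  rw [Finset.mem_add] at this
  obtain ⟨T₁, hT₁, T₂, hT₂, rfl⟩ := this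
  exact Finsupp.support_add.trans (Finset.union_subset_union (hx T₁ hT₁) (hz T₂ hT₂))

/-- Powers stay bounded. [folklore] -/
theorem SuppIn.pow {B : Finset ℕ} {x : ParityAlg} (hx : SuppIn B x) : ∀ n : ℕ, SuppIn B (x ^ n)
  | 0 => by rw [pow_zero]; exact suppIn_one B
  | n + 1 => by
    rw [pow_succ]
    simpa using (hx.pow n).mul hx

/-- Finite products: bounding sets unite. [folklore] -/
theorem SuppIn.prod {κ : Type*} [DecidableEq κ] {B : κ → Finset ℕ} {s : Finset κ}
    {f : κ → ParityAlg} (h : ∀ i ∈ s, SuppIn (B i) (f i)) :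
    SuppIn (s.biUnion B) (∏ i ∈ s, f i) := by
  induction s using Finset.induction_on with
  | empty => rw [Finset.prod_empty]; exact suppIn_one _
  | insert a s ha ih =>
    rw [Finset.prod_insert ha, Finset.biUnion_insert]
    exact (h a (Finset.mem_insert_self a s)).mul (ih fun i hi => h i (Finset.mem_insert_of_mem hi))

/-- `phi (x_v)` only involves the variable `v`. [folklore] -/
theorem suppIn_phiX (v : ℕ) : SuppIn {v} (phiX v) := by
  unfold phiX yMon
  exact ((suppIn_one _).sub (suppIn_single Finsupp.support_single_subset 1)).smul _

/-- `phi` of a monomial `x^α` only involves the variables of `α`. [folklore] -/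
theorem suppIn_phi_monomial (α : ℕ →₀ ℕ) (a : ℝ) : SuppIn α.support (phi (monomial α a)) := by
  classical
  rw [phi, MvPolynomial.aeval_monomial, Finsupp.prod]
  have h1 : SuppIn ∅ (algebraMap ℝ ParityAlg a) := by
    rw [AddMonoidAlgebra.coe_algebraMap, Function.comp_apply, Algebra.algebraMap_self_apply]
    exact suppIn_single (by simp) a
  have h2 : SuppIn (α.support.biUnion fun v => {v}) (∏ v ∈ α.support, phiX v ^ α v) :=
    SuppIn.prod fun v _ => (suppIn_phiX v).pow _
  rw [Finset.biUnion_singleton_eq_self] at h2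
  simpa using h1.mul h2

/-- **Degree control.** Every monomial `y_T` of `phi p` has `|T| ≤ deg p`. [Grigoriev 2001, §2;
Schoenebeck 2008, §5] [folklore] -/
theorem card_support_le_totalDegree (p : MvPolynomial ℕ ℝ) {T : ParityVec}
    (hT : T ∈ (phi p).coeff.support) : T.support.card ≤ p.totalDegree := by
  classical
  rw [p.as_sum, map_sum, AddMonoidAlgebra.coeff_sum] at hT
  obtain ⟨α, hα, hTα⟩ := Finset.mem_biUnion.1 (Finsupp.support_finsetSum hT)
  have hsub : T.support ⊆ α.support := suppIn_phi_monomial α _ T hTα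
  refine (Finset.card_le_card hsub).trans (le_trans ?_ (MvPolynomial.le_totalDegree hα))
  rw [Finsupp.sum, Finset.card_eq_sum_ones]
  exact Finset.sum_le_sum fun v hv => Nat.one_le_iff_ne_zero.2 (Finsupp.mem_support_iff.1 hv)

/-! ### Clauses under `phi`: the Fourier expansion of `unsatPoly C` -/

/-- The `±1` sign of a literal: `+1` for a positive literal `(v, true)` (falsified iff `y_v = +1`,
i.e. `x_v = 0`), `-1` for a negative one. [Schoenebeck 2008, §5] [folklore] -/
def litSign (l : Literal ℕ) : ℝ :=
  if l.2 then 1 else -1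

/-- `litSign l = ±1`. [folklore] -/
theorem litSign_mul_self (l : Literal ℕ) : litSign l * litSign l = 1 := by
  unfold litSign; split <;> norm_num

/-- `(1 - y_v)/2` in the monomial basis. [folklore] -/
theorem phiX_eq (v : ℕ) : phiX v =
    AddMonoidAlgebra.single 0 (1 / 2) - AddMonoidAlgebra.single (Finsupp.single v 1) (1 / 2) := by
  rw [phiX, smul_sub, AddMonoidAlgebra.one_def, AddMonoidAlgebra.smul_single', yMon,
    AddMonoidAlgebra.smul_single', mul_one]

/-- The falsity polynomial of a literal becomes `(1 + s_l y_v)/2`. [Schoenebeck 2008, §5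
(from SAT constraints to parity constraints)] [folklore] -/
theorem phi_litFalsePoly (l : Literal ℕ) : phi (litFalsePoly l) =
    AddMonoidAlgebra.single 0 (1 / 2) + AddMonoidAlgebra.single (Finsupp.single l.1 1) (litSign l / 2) := by
  rcases l with ⟨v, _ | _⟩
  · simp only [litFalsePoly, litSign, Bool.false_eq_true, if_false, phi_X, phiX_eq]
    rw [sub_eq_add_neg, ← AddMonoidAlgebra.single_neg]
    norm_num
  · simp only [litFalsePoly, litSign, if_true, map_sub, map_one, phi_X, phiX_eq]
    have h : (AddMonoidAlgebra.single 0 1 : ParityAlg) - AddMonoidAlgebra.single 0 (1 / 2) =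
        AddMonoidAlgebra.single 0 (1 / 2) := by
      rw [← AddMonoidAlgebra.single_sub]; norm_num
    rw [AddMonoidAlgebra.one_def,
      show ∀ S A B : ParityAlg, S - (A - B) = (S - A) + B from fun S A B => by abel, h]

/-- The parity vector of a set `J` of literal POSITIONS of a clause: `Σ_{j ∈ J} e_{var(C_j)}`.
[Schoenebeck 2008, §5] [folklore] -/
def litVec (C : Clause ℕ) (J : Finset (Fin C.length)) : ParityVec :=
  ∑ j ∈ J, Finsupp.single (C[j]).1 1

/-- The SCOPE VECTOR of a clause (all positions). [Schoenebeck 2008, §4–5] [folklore] -/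
def clauseVec (C : Clause ℕ) : ParityVec :=
  litVec C Finset.univ

/-- The sign of a set of literal positions: `∏_{j ∈ J} s_{C_j}`. [Schoenebeck 2008, §5] [folklore] -/
def posSign (C : Clause ℕ) (J : Finset (Fin C.length)) : ℝ :=
  ∏ j ∈ J, litSign C[j]

/-- The right-hand side of the parity constraint implied by a clause: `y_{scope} = -∏_j s_j`
("an odd number of true literals"; all literals false gives `y_{scope} = ∏_j s_j`).
[Schoenebeck 2008, §5; Kothari–Mori–O'Donnell–Witmer 2017, §1.5 (OR supports the odd-parity
distribution)] [folklore] -/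
def clauseSign (C : Clause ℕ) : ℝ :=
  -posSign C Finset.univ

/-- `posSign C J = ±1`. [folklore] -/
theorem posSign_mul_self (C : Clause ℕ) (J : Finset (Fin C.length)) : posSign C J * posSign C J = 1 := by
  rw [posSign, ← Finset.prod_mul_distrib]
  exact Finset.prod_eq_one fun j _ => litSign_mul_self _

/-- `clauseSign C = ±1`. [folklore] -/
theorem clauseSign_mul_self (C : Clause ℕ) : clauseSign C * clauseSign C = 1 := by
  rw [clauseSign, neg_mul_neg, posSign_mul_self]

/-- Complementary positions: `σ_{Jᶜ} = σ_{all} σ_J`. [folklore] -/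
theorem posSign_compl (C : Clause ℕ) (J : Finset (Fin C.length)) :
    posSign C (Finset.univ \ J) = posSign C Finset.univ * posSign C J := by
  have h := Finset.prod_sdiff (f := fun j => litSign C[j]) (Finset.subset_univ J)
  have h2 := posSign_mul_self C J
  unfold posSign at *
  rw [← h]
  linear_combination -(∏ x ∈ univ \ J, litSign C[x]) * h2

/-- Complementary positions: `litVec Jᶜ = clauseVec + litVec J` (characteristic two). [folklore] -/
theorem litVec_compl (C : Clause ℕ) (J : Finset (Fin C.length)) :
    litVec C (Finset.univ \ J) = clauseVec C + litVec C J := by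
  have h := Finset.sum_sdiff (f := fun j => (Finsupp.single (C[j]).1 1 : ParityVec))
    (Finset.subset_univ J)
  unfold clauseVec litVec
  rw [← h, add_assoc, ParityVec.add_self, add_zero]

/-- A set of `|J|` positions gives a parity vector of support `≤ |J|`. [folklore] -/
theorem card_support_litVec_le (C : Clause ℕ) (J : Finset (Fin C.length)) :
    (litVec C J).support.card ≤ J.card := by
  classical
  unfold litVec
  refine (Finset.card_le_card (Finsupp.support_finsetSum)).trans ?_
  refine (Finset.card_biUnion_le).trans ?_
  calc ∑ j ∈ J, (Finsupp.single (C[j]).1 (1 : ZMod 2)).support.card ≤ ∑ j ∈ J, 1 :=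
        Finset.sum_le_sum fun j _ => (Finset.card_le_card Finsupp.support_single_subset).trans
          (by simp)
    _ = J.card := by simp

/-- The scope vector has support of size at most the clause length. [folklore] -/
theorem card_support_clauseVec_le (C : Clause ℕ) : (clauseVec C).support.card ≤ C.length := by
  unfold clauseVec
  exact (card_support_litVec_le C _).trans (by simp)

/-- **Fourier expansion of a clause**: `phi (unsatPoly C) = 2^{-k} Σ_{J ⊆ positions} σ_J y_{litVec J}`.
[Schoenebeck 2008, §5; Kothari–Mori–O'Donnell–Witmer 2017, §2.1 (arithmetisation)] [folklore] -/
theorem phi_unsatPoly (C : Clause ℕ) :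
    phi (unsatPoly C) = ∑ J ∈ (Finset.univ : Finset (Fin C.length)).powerset,
      AddMonoidAlgebra.single (litVec C J) ((1 / 2) ^ C.length * posSign C J) := by
  have h1 : unsatPoly C = ∏ j : Fin C.length, litFalsePoly C[j] := by
    rw [unsatPoly, ← List.prod_ofFn]
    congr 1
    exact (List.ofFn_getElem_eq_map C litFalsePoly).symm
  rw [h1, map_prod]
  simp_rw [phi_litFalsePoly, add_comm (AddMonoidAlgebra.single (0 : ParityVec) _)]
  rw [Finset.prod_add]
  refine Finset.sum_congr rfl fun J hJ => ?_
  rw [AddMonoidAlgebra.prod_single, AddMonoidAlgebra.prod_single, Finset.sum_const_zero,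
    Finset.prod_const, AddMonoidAlgebra.single_mul_single, add_zero]
  congr 1
  have hJ : J.card ≤ C.length := by simpa using Finset.card_le_univ J
  rw [Finset.prod_div_distrib, Finset.prod_const, Finset.card_sdiff_of_subset (Finset.subset_univ J),
    Finset.card_univ, Fintype.card_fin, posSign, pow_sub₀ _ (by norm_num : (1 / 2 : ℝ) ≠ 0) hJ]
  field_simp
  rw [mul_assoc, ← mul_pow]
  norm_num

/-- The falsity polynomial of a literal has degree one. [folklore] -/
theorem totalDegree_litFalsePoly (l : Literal ℕ) : (litFalsePoly l).totalDegree = 1 := by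
  unfold litFalsePoly
  split
  · rw [show (1 : MvPolynomial ℕ ℝ) - X l.1 = -X l.1 + 1 by ring,
      totalDegree_add_eq_left_of_totalDegree_lt, totalDegree_neg, totalDegree_X]
    rw [totalDegree_neg, totalDegree_X, totalDegree_one]
    exact zero_lt_one
  · exact totalDegree_X _

/-- Hence it is nonzero. [folklore] -/
theorem litFalsePoly_ne_zero (l : Literal ℕ) : litFalsePoly l ≠ 0 := by
  intro h
  have := totalDegree_litFalsePoly l
  rw [h, totalDegree_zero] at this
  exact zero_ne_one this

/-- `unsatPoly C ≠ 0`. [folklore] -/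
theorem unsatPoly_ne_zero (C : Clause ℕ) : unsatPoly C ≠ 0 := by
  induction C with
  | nil => simp [unsatPoly]
  | cons l C ih =>
    rw [unsatPoly, List.map_cons, List.prod_cons]
    exact mul_ne_zero (litFalsePoly_ne_zero l) ih

/-- **Degree of a clause polynomial**: `deg (unsatPoly C) = |C|`. [Kothari–Mori–O'Donnell–Witmer
2017, §2.1] [folklore] -/
theorem totalDegree_unsatPoly (C : Clause ℕ) : (unsatPoly C).totalDegree = C.length := by
  induction C with
  | nil => simp [unsatPoly]
  | cons l C ih =>
    have h : unsatPoly (l :: C) = litFalsePoly l * unsatPoly C := by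
      rw [unsatPoly, List.map_cons, List.prod_cons]; rfl
    rw [h, totalDegree_mul_of_isDomain (litFalsePoly_ne_zero l) (unsatPoly_ne_zero C),
      totalDegree_litFalsePoly, ih, List.length_cons, add_comm]

/-! ### The clause identities via the complement pairing -/

section Pairing

variable {ι : Type*} [DecidableEq ι] {g : ι → ParityVec} {b : ι → ℝ} {r c : ℝ} {d : ℕ}

/-- **The pairing.** For a clause `C` sitting at index `i` of an expanding family and `U` with
`|U| + |C| ≤ d`: `Σ_{J ⊆ positions} σ_J Ẽ[y_{litVec J + U}] = 0`, by the fixed-point-free involution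
`J ↦ positions ∖ J` (the two terms cancel because `b i = -σ_{all}`). [Grigoriev 2001, §2 (parity
axioms); Schoenebeck 2008, §5 (proof of Thm. 5.1)] [folklore] -/
theorem sum_posSign_pseudoMoment_eq_zero (hexp : VecExpands g r c) (hc : 0 < c)
    (hd : (d : ℝ) ≤ c * r / 2) (hr : 2 ≤ r) (hb : ∀ i, b i * b i = 1) (C : Clause ℕ)
    (hC : 0 < C.length) (i : ι) (hgi : g i = clauseVec C) (hbi : b i = clauseSign C)
    (U : ParityVec) (hU : U.support.card + C.length ≤ d) :
    ∑ J ∈ (Finset.univ : Finset (Fin C.length)).powerset,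
      posSign C J * pseudoMoment g b r d (litVec C J + U) = 0 := by
  refine Finset.sum_involution (fun J _ => Finset.univ \ J) ?_ ?_ ?_ ?_
  · -- cancellation in pairs
    intro J hJ
    have hT : (litVec C J + U).support.card ≤ d := by
      have h1 := card_support_add_le (litVec C J) U
      have h2 := card_support_litVec_le C J
      have h3 : J.card ≤ C.length := by simpa using Finset.card_le_univ J
      omega
    have hT' : (g i + (litVec C J + U)).support.card ≤ d := by
      have h1 := card_support_add_le (g i) (litVec C J + U)
      have h1' := card_support_add_le (litVec C (Finset.univ \ J)) U
      have h2 := card_support_litVec_le C (Finset.univ \ J)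
      have h3 : (Finset.univ \ J).card ≤ C.length := by
        simpa using Finset.card_le_univ (Finset.univ \ J)
      rw [hgi, ← add_assoc, ← litVec_compl]
      omega
    rw [litVec_compl, posSign_compl, ← hgi, add_assoc]
    have hs := posSign_mul_self C Finset.univ
    by_cases hD : Derivable g r d (litVec C J + U)
    · rw [(pseudoMoment_index_add hexp hc hd hr hb i hD hT').2, hbi, clauseSign]
      linear_combination (-(posSign C J) * pseudoMoment g b r d (litVec C J + U)) * hs
    · rw [pseudoMoment_of_not hD,
        pseudoMoment_of_not (not_derivable_index_add hexp hc hd hr hb i hD hT)]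
      ring
  · -- no fixed points
    intro J hJ _ hfix
    have hne : (Finset.univ : Finset (Fin C.length)).Nonempty :=
      Finset.univ_nonempty_iff.2 ⟨⟨0, hC⟩⟩
    have h1 : J ∩ (Finset.univ \ J) = ∅ := Finset.inter_sdiff_self J Finset.univ
    rw [hfix, Finset.inter_self] at h1
    rw [h1, Finset.sdiff_empty] at hfix
    exact hne.ne_empty hfix
  · intro J hJ
    exact Finset.mem_powerset.2 (Finset.subset_univ _)
  · intro J hJ
    exact Finset.sdiff_sdiff_eq_self (Finset.mem_powerset.1 hJ)

/-- **Clause identity for the moment functional**: `L(phi(unsatPoly C) · z) = 0` whenever every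
monomial `y_U` of `z` has `|U| + |C| ≤ d`. [Grigoriev 2001, §2; Schoenebeck 2008, Thm. 5.1] [folklore] -/
theorem momentFunctional_phi_unsatPoly_mul (hexp : VecExpands g r c) (hc : 0 < c)
    (hd : (d : ℝ) ≤ c * r / 2) (hr : 2 ≤ r) (hb : ∀ i, b i * b i = 1) (C : Clause ℕ)
    (hC : 0 < C.length) (i : ι) (hgi : g i = clauseVec C) (hbi : b i = clauseSign C)
    (z : ParityAlg) (hz : ∀ U ∈ z.coeff.support, U.support.card + C.length ≤ d) :
    momentFunctional (pseudoMoment g b r d) (phi (unsatPoly C) * z) = 0 := by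
  rw [phi_unsatPoly, Finset.sum_mul, map_sum]
  simp_rw [momentFunctional_single_mul]
  rw [Finset.sum_comm]
  refine Finset.sum_eq_zero fun U hU => ?_
  have h := sum_posSign_pseudoMoment_eq_zero hexp hc hd hr hb C hC i hgi hbi U (hz U hU)
  calc ∑ J ∈ (Finset.univ : Finset (Fin C.length)).powerset,
        (1 / 2) ^ C.length * posSign C J * z.coeff U * pseudoMoment g b r d (litVec C J + U)
      = (1 / 2) ^ C.length * z.coeff U * ∑ J ∈ (Finset.univ : Finset (Fin C.length)).powerset,
          posSign C J * pseudoMoment g b r d (litVec C J + U) := by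
        rw [Finset.mul_sum]
        exact Finset.sum_congr rfl fun J _ => by ring
    _ = 0 := by rw [h, mul_zero]

end Pairing

/-! ### From boundary expansion of the scopes to vector expansion -/

section Boundary

variable {ι : Type*} [DecidableEq ι]

/-- A unique neighbour of `F` has degree one, hence odd degree: the boundary lies in the support
of the summed scope vector. [Ben-Sasson–Wigderson 2001, §5; Schoenebeck 2008, §4] [folklore] -/
theorem boundary_subset_support_famVec (S : ι → Finset ℕ) (F : Finset ι) :
    boundary S F ⊆ (famVec (fun i => indVec (S i)) F).support := by
  intro v hv
  rw [mem_boundary] at hv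
  rw [Finsupp.mem_support_iff, famVec, Finsupp.finsetSum_apply]
  simp_rw [indVec_apply]
  rw [Finset.sum_boole]
  have : (F.filter fun i => v ∈ S i).card = 1 := hv.2
  rw [this]
  simp

/-- Boundary expansion of the scopes gives vector expansion of their indicator vectors.
[Schoenebeck 2008, §4] [folklore] -/
theorem vecExpands_of_isBoundaryExpander {S : ι → Finset ℕ} {r c : ℝ}
    (h : IsBoundaryExpander S r c) : VecExpands (fun i => indVec (S i)) r c := by
  intro F hF
  refine (h F hF).trans ?_
  exact_mod_cast Finset.card_le_card (boundary_subset_support_famVec S F)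


/-- The indicator vector as a sum of unit vectors. [folklore] -/
theorem indVec_eq_sum (A : Finset ℕ) : indVec A = ∑ v ∈ A, Finsupp.single v 1 := by
  ext w
  rw [indVec_apply, Finsupp.finsetSum_apply]
  simp only [Finsupp.single_apply]
  rw [Finset.sum_ite_eq']

/-- For a clause on pairwise distinct variables the scope vector is the indicator of the scope.
[folklore] -/
theorem clauseVec_eq_indVec {C : Clause ℕ} (h : (C.map Prod.fst).Nodup) :
    clauseVec C = indVec (clauseScope C) := by
  classical
  have hinj : ∀ j₁ ∈ (Finset.univ : Finset (Fin C.length)),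
      ∀ j₂ ∈ (Finset.univ : Finset (Fin C.length)), (C[j₁]).1 = (C[j₂]).1 → j₁ = j₂ := by
    intro j₁ _ j₂ _ hj
    have e1 : (C.map Prod.fst)[j₁.1]'(by simp) = (C[j₁]).1 := List.getElem_map ..
    have e2 : (C.map Prod.fst)[j₂.1]'(by simp) = (C[j₂]).1 := List.getElem_map ..
    exact Fin.ext ((h.getElem_inj_iff).1 (e1.trans (hj.trans e2.symm)))
  rw [clauseVec, litVec, ← Finset.sum_image (f := fun v => (Finsupp.single v (1 : ZMod 2))) hinj,
    indVec_eq_sum]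
  congr 1
  ext v
  simp only [Finset.mem_image, Finset.mem_univ, true_and, clauseScope, List.mem_toFinset,
    List.mem_map]
  constructor
  · rintro ⟨j, rfl⟩
    exact ⟨C[j], List.getElem_mem .., rfl⟩
  · rintro ⟨p, hp, rfl⟩
    obtain ⟨n, hn, rfl⟩ := List.mem_iff_getElem.1 hp
    exact ⟨⟨n, hn⟩, rfl⟩

end Boundary

/-! ### The pseudoexpectation of a CNF and the deterministic theorem -/

section Main

/-- The scope vectors of the clauses of a CNF, by position. [Schoenebeck 2008, §4] [folklore] -/
def cnfVecs (φ : CNF ℕ) : Fin φ.length → ParityVec :=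
  fun i => clauseVec φ[i]

/-- The parity right-hand sides `b_i = ±1` of the clauses of a CNF, by position. [Schoenebeck 2008,
§5] [folklore] -/
def cnfSigns (φ : CNF ℕ) : Fin φ.length → ℝ :=
  fun i => clauseSign φ[i]

/-- **The Grigoriev–Schoenebeck pseudoexpectation** of a CNF at radius `r` and degree `d`:
`p ↦ L(phi p)` where `L(y_T) = Ẽ[y_T]` is the pseudo-moment of the parity system
`y_{scope(C_i)} = b_i`. [Grigoriev 2001, §2; Schoenebeck 2008, §4–5; Kothari–Mori–O'Donnell–Witmer
2017, §3.1] [folklore] -/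
def gsPseudoexpectation (φ : CNF ℕ) (r : ℝ) (d : ℕ) : MvPolynomial ℕ ℝ →ₗ[ℝ] ℝ :=
  momentFunctional (pseudoMoment (cnfVecs φ) (cnfSigns φ) r d) ∘ₗ phi.toLinearMap

/-- **Grigoriev–Schoenebeck, vector form.** If the scope vectors of `φ` are `(r, c)`-vector
expanding with `c > 0`, `r ≥ 2`, then for every `d ≤ c r / 2` the functional
`gsPseudoexpectation φ r d` is a degree-`d` pseudoexpectation satisfying Booleanity and all clause
identities; in particular degree-`d` SOS fails to refute `φ`. [Grigoriev 2001, Thm. 1 / §2;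
Schoenebeck 2008, Thm. 4.1 with §5; Kothari–Mori–O'Donnell–Witmer 2017, Thm. 2.9 (general form)] [folklore] -/
theorem sosFailsToRefute_of_vecExpands (φ : CNF ℕ) {r c : ℝ} {d : ℕ}
    (hexp : VecExpands (cnfVecs φ) r c) (hc : 0 < c) (hr : 2 ≤ r) (hd : (d : ℝ) ≤ c * r / 2) :
    SOSFailsToRefute d φ := by
  classical
  have hb : ∀ i, cnfSigns φ i * cnfSigns φ i = 1 := fun i => clauseSign_mul_self _
  have hr0 : (0 : ℝ) ≤ r := by linarith
  refine ⟨gsPseudoexpectation φ r d, ⟨?_, ?_⟩, ?_, ?_⟩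
  · -- normalisation
    show momentFunctional _ (phi 1) = 1
    rw [map_one, AddMonoidAlgebra.one_def, momentFunctional_single, one_mul,
      pseudoMoment_zero hexp hc hd hr0]
  · -- positivity
    intro p hp
    show 0 ≤ momentFunctional _ (phi (p * p))
    rw [map_mul, momentFunctional_mul]
    refine pseudoMoment_quadratic_nonneg hexp hc hd hr0 hb _ (fun T => (phi p).coeff T) ?_
    intro T hT
    have := card_support_le_totalDegree p hT
    omega
  · -- Booleanity
    intro v q _
    show momentFunctional _ (phi (boolAxiom v * q)) = 0
    rw [map_mul, phi_boolAxiom, zero_mul, map_zero]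
  · -- clause identities
    intro C hC q hq
    obtain ⟨n, hn, hCn⟩ := List.mem_iff_getElem.1 hC
    let i : Fin φ.length := ⟨n, hn⟩
    have hφi : φ[i] = C := hCn
    have hgi : cnfVecs φ i = clauseVec C := by rw [cnfVecs, hφi]
    have hbi : cnfSigns φ i = clauseSign C := by rw [cnfSigns, hφi]
    have hlen : 0 < C.length := by
      have h1 := hexp {i} (by rw [Finset.card_singleton, Nat.cast_one]; linarith)
      rw [famVec_singleton, hgi, Finset.card_singleton, Nat.cast_one, mul_one] at h1
      have h2 := card_support_clauseVec_le C
      have h3 : 0 < (clauseVec C).support.card := by exact_mod_cast hc.trans_le h1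
      omega
    show momentFunctional _ (phi (unsatPoly C * q)) = 0
    rw [map_mul]
    refine momentFunctional_phi_unsatPoly_mul hexp hc hd hr hb C hlen i hgi hbi (phi q) ?_
    intro U hU
    have := card_support_le_totalDegree q hU
    rw [totalDegree_unsatPoly] at hq
    omega

/-- **Grigoriev–Schoenebeck from boundary expansion** (the deterministic half of KMOW Thm. 7.1
for `k`-SAT). If the clauses of `φ` have pairwise distinct variables and their scopes form an
`(r, c)`-boundary expander (`c > 0`, `r ≥ 2`), then degree-`d` SOS fails to refute `φ` for every
`d ≤ c r / 2`. [Grigoriev 2001, Thm. 1; Schoenebeck 2008, Thm. 4.1, Lemma 4.4, §5;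
Kothari–Mori–O'Donnell–Witmer 2017, Thm. 2.9] [folklore] -/
theorem sosFailsToRefute_of_isBoundaryExpander (φ : CNF ℕ) {r c : ℝ} {d : ℕ}
    (hnd : ∀ C ∈ φ, (C.map Prod.fst).Nodup) (hexp : IsBoundaryExpander (cnfScopes φ) r c)
    (hc : 0 < c) (hr : 2 ≤ r) (hd : (d : ℝ) ≤ c * r / 2) : SOSFailsToRefute d φ := by
  classical
  refine sosFailsToRefute_of_vecExpands φ ?_ hc hr hd
  have h : cnfVecs φ = fun i => indVec (cnfScopes φ i) := by
    funext i
    exact clauseVec_eq_indVec (hnd _ (List.getElem_mem ..))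
  rw [h]
  exact vecExpands_of_isBoundaryExpander hexp

end Main

end Literature.Computability.MetaComplexity
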